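import Summits.ResolutionOfSingularities.ResolutionOfSingularities.Theorems.LossExitCone2
import HarnessLib

/-!
# LossExitCone4 — decomp-res node «LossExitCone» (lens-3 g27 «LossLayer» rev 3 addendum; critic row 220 + addendum;
LANDING ASK INBOX :1644), tree file 4/5 of the node

Content VERBATIM from the decomp-res lens-3 g27 «LossLayer» rev 3 addendum files
`HOME/decomp-res-lens-3/g27/land/LossExitCone{,2,3}.lean` (5d9cd97a / b64a38c9 / 60e238a8; RE-PIN STATUS 13:02:33Z;
critic row 220 + addendum); tree names LossExitCone/2 = lens (4), LossExitCone3 = lens (5), LossExitCone4/5 = lens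
(6) — provenance and the lens header in full in `LossExitCone`. `--kind proof --supports
stmt-ResolutionOfSingularities-27367`; no aside change, no item.

## This file

§4 `section Switch` — the SIDE SWITCH (exit type X2): a plateau move in the FREE chart from a run state; RUN STATES
ARE CLOSED UNDER NON-LOSS PLATEAU MOVES.  (The 400-line cap cuts this group into 2 files; this first part carries:
`fin3_eq_or`, `finsupp_fin3_eq`, `degree_fin3`, `coeff_single_X_sub_C_pow`, `eq_zero_of_translate_free`,
`switch_law`, `switch_resLayer`, `switch_initialForm`, `switch_succ_layer`, `switch_succ_r`.)

[WRITER NOTE (decomp-res writer g14): file split only (tree files ≤ 400 lines) — cut at the node's section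
boundaries where possible (§1 | §2; §3–§3⁺ whole; §4 by the cap between two declarations with `section Switch` and
its `variable` line replayed); file-level `open` lines replayed in every part; every declaration, docstring and `/-!
## § -/` comment exactly as in the lens files.]

(Sources: Hauser2010 §F; HauserPerlega2019 §2; CossartJannsenSaito2020 Ch. 8; Moh1987; Perlega2022.)
-/

open MvPolynomial Finset
open Literature.AlgebraicGeometry.Resolution
open Literature.AlgebraicGeometry.Resolution.Hauser2010
open Literature.AlgebraicGeometry.Resolution.PointBlowup
open Literature.AlgebraicGeometry.Resolution.WeightedBlowup
open Summit.ResolutionOfSingularities.ResolutionOfSingularities.Theorems.TightDefectClasses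
open Summit.ResolutionOfSingularities.ResolutionOfSingularities.Theorems.TightDefectStrongWalks
open Summit.ResolutionOfSingularities.ResolutionOfSingularities.Theorems.ItineraryCutClasses
open Summit.ResolutionOfSingularities.ResolutionOfSingularities.Theorems.BoundaryLedger
open Summit.ResolutionOfSingularities.ResolutionOfSingularities.Theorems.ProximityCut
open Summit.ResolutionOfSingularities.ResolutionOfSingularities.Theorems.ConeCut
open Summit.ResolutionOfSingularities.ResolutionOfSingularities.Theorems.WallCutRun

namespace Summit.ResolutionOfSingularities.ResolutionOfSingularities.Theorems.LossExitCone

section Switch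

variable {K : Type} [Field K] [DecidableEq K] {q : ℕ} {s₀ : State (Fin 3) K}

/-! ### §4 The side switch (exit type X2): a plateau move in the FREE chart from a run state

Pure algebra first (`Fin 3` bookkeeping, the `u_j`-free coefficients of `(u_j − γ)^n`, and the RIGIDITY OF A TRANSLATED BINARY
FORM), then the switch law `switch_law`. -/

/-- Three pairwise distinct letters exhaust `Fin 3`. [folklore] -/
theorem fin3_eq_or (i j l w : Fin 3) (hij : i ≠ j) (hil : i ≠ l) (hjl : j ≠ l) : w = i ∨ w = j ∨ w = l := by
  revert i j l w
  decide

/-- An exponent on `Fin 3` is the sum of its three singles (letters pairwise distinct). [folklore] -/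
theorem finsupp_fin3_eq {i j l : Fin 3} (hij : i ≠ j) (hil : i ≠ l) (hjl : j ≠ l) (E : Fin 3 →₀ ℕ) :
    E = Finsupp.single i (E i) + Finsupp.single j (E j) + Finsupp.single l (E l) := by
  ext w
  simp only [Finsupp.add_apply, Finsupp.single_apply]
  rcases fin3_eq_or i j l w hij hil hjl with hw | hw | hw
  · subst hw
    rw [if_pos rfl, if_neg (Ne.symm hij), if_neg (Ne.symm hil), add_zero, add_zero]
  · subst hw
    rw [if_neg hij, if_pos rfl, if_neg (Ne.symm hjl), zero_add, add_zero]
  · subst hw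
    rw [if_neg hil, if_neg hjl, if_pos rfl, zero_add, zero_add]

/-- The degree of an exponent on `Fin 3` is the sum of its three entries (letters pairwise distinct). [folklore] -/
theorem degree_fin3 {i j l : Fin 3} (hij : i ≠ j) (hil : i ≠ l) (hjl : j ≠ l) (E : Fin 3 →₀ ℕ) :
    E.degree = E i + E j + E l := by
  conv_lhs => rw [finsupp_fin3_eq hij hil hjl E]
  rw [map_add, map_add, Finsupp.degree_single, Finsupp.degree_single, Finsupp.degree_single]

omit [DecidableEq K] in
/-- The `u_j`-free coefficients of `(u_j − γ)^n` on the `u_i`-axis: only the constant `(−γ)^n`. [folklore] -/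
theorem coeff_single_X_sub_C_pow {i j : Fin 3} (hij : i ≠ j) (γ : K) (n c : ℕ) :
    coeff (Finsupp.single i c) ((X j - C γ : MvPolynomial (Fin 3) K) ^ n) = if c = 0 then (-γ) ^ n else 0 := by
  classical
  by_cases hc : c = 0
  · rw [if_pos hc, hc, Finsupp.single_zero, X_sub_C_pow_eq_sum, coeff_sum, Finset.sum_eq_single 0]
    · rw [coeff_monomial, Finsupp.single_zero, if_pos rfl, Nat.choose_zero_right, Nat.cast_one, one_mul, Nat.sub_zero]
    · intro t _ ht
      rw [coeff_monomial, if_neg]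
      intro h
      apply ht
      have h' := DFunLike.congr_fun h j
      rwa [Finsupp.single_eq_same, Finsupp.zero_apply] at h'
    · intro h
      exact absurd (Finset.mem_range.mpr (Nat.succ_pos n)) h
  · rw [if_neg hc]
    exact coeff_X_sub_C_pow_eq_zero j γ (w := i) hij (by rwa [Finsupp.single_eq_same])

/-- **RIGIDITY OF A TRANSLATED BINARY FORM (pure algebra, PROVED):** a form `Ψ` of degree `n` in the letters `i, j`
only (no letter `l`) whose translate by `b` with `b j ≠ 0` has NO `u_j`-free monomial is ZERO.  (Look at the monomial of
`Ψ` of largest `u_i`-degree: its translate contributes `Ψ_A · b_j^{A_j} ≠ 0` to the `u_j`-free coefficient `u_i^{A_i}`, and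
nothing else does.) [folklore] -/
theorem eq_zero_of_translate_free (b : Fin 3 → K) {i j l : Fin 3} (hij : i ≠ j) (hil : i ≠ l) (hjl : j ≠ l)
    (hbj : b j ≠ 0) (Ψ : MvPolynomial (Fin 3) K) {n : ℕ} (hΨ : Ψ.IsHomogeneous n) (hl : ∀ A ∈ Ψ.support, A l = 0)
    (hfree : ∀ c : ℕ, coeff (Finsupp.single i c) (PointBlowup.translate b Ψ) = 0) : Ψ = 0 := by
  classical
  by_contra hne
  have hS : Ψ.support.Nonempty := by
    obtain ⟨d, hd⟩ := MvPolynomial.ne_zero_iff.mp hne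
    exact ⟨d, mem_support_iff.mpr hd⟩
  obtain ⟨A, hA, hmax⟩ := Finset.exists_max_image Ψ.support (fun A => A i) hS
  have hdeg : ∀ A' ∈ Ψ.support, A'.degree = n := fun A' hA' => by
    by_contra h
    exact (mem_support_iff.mp hA') (hΨ.coeff_eq_zero h)
  have key : coeff (Finsupp.single i (A i)) (PointBlowup.translate b Ψ) = coeff A Ψ * b j ^ (A j) := by
    conv_lhs => rw [Ψ.as_sum, PointBlowup.translate_finset_sum, coeff_sum]
    rw [Finset.sum_eq_single A]
    · rw [coeff_translate_monomial]
      congr 1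
      rw [Finset.prod_eq_single j]
      · rw [Finsupp.single_eq_of_ne hij.symm, Nat.choose_zero_right, Nat.cast_one, one_mul, Nat.sub_zero]
      · intro w _ hwj
        rcases fin3_eq_or i j l w hij hil hjl with hw | hw | hw
        · rw [hw, Finsupp.single_eq_same, Nat.choose_self, Nat.cast_one, one_mul, Nat.sub_self, pow_zero]
        · exact absurd hw hwj
        · rw [hw, hl A hA, Finsupp.single_eq_of_ne hil.symm, Nat.choose_zero_right, Nat.cast_one, one_mul, Nat.sub_zero,
            pow_zero]
      · intro h
        exact absurd (Finset.mem_univ j) h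
    · intro A' hA' hne'
      by_cases hlt : A' i < A i
      · exact coeff_translate_monomial_eq_zero_of_lt b A' _ _ (by rwa [Finsupp.single_eq_same])
      · exfalso
        apply hne'
        have heq : A' i = A i := le_antisymm (hmax A' hA') (not_lt.mp hlt)
        have h1 := hdeg A hA
        have h2 := hdeg A' hA'
        rw [degree_fin3 hij hil hjl, hl A hA] at h1
        rw [degree_fin3 hij hil hjl, hl A' hA'] at h2
        have hjA : A' j = A j := by omega
        rw [finsupp_fin3_eq hij hil hjl A', finsupp_fin3_eq hij hil hjl A, heq, hjA, hl A' hA', hl A hA]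
    · intro h
      exact absurd hA h
  have h := hfree (A i)
  rw [key] at h
  rcases mul_eq_zero.mp h with h | h
  · exact (mem_support_iff.mp hA) h
  · exact pow_ne_zero _ hbj h

/-- **X2 SWITCH LAW (PROVED): a plateau move in the FREE chart `l = W.j u` from a run state LEAVES THE LOSS WALL, and its
residual form is the pure power `φ₀ · u_j^s`, `φ₀ = c·V(0) / (−β_j)^s`, `β_j = W.b u j ≠ 0`.**  Setting: walls `i` (mass
`k`) and `j` (mass `m`), free letter `l = W.j u`, shade `s ≥ 1`, order `> q`, the `u_j^m`-layer of `F_u` equal to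
`c · u_i^k u_j^m u_l^s · V` with `c·V(0) ≠ 0`.  Mechanism: the cone law `ConeCut.cone_of_plateau` makes
`Φ = resForm W u o = R(u + b)` a non-zero FORM of degree `s`, `R` the dehomogenised residual layer (`u_l = 1`); the layer
hypothesis pins the `u_j`-free part of `R` to the constant `c·V(0)`; if `β_j = 0` the `u_j`-free part of `Φ` would be the
translate of a constant and of top degree `s ≥ 1` at once — absurd; if `β_j ≠ 0`, `Φ − φ₀ u_j^s` is a form killed by
`eq_zero_of_translate_free`.  (The first conclusion re-proves T4⁰ «no move in the third chart stays on the loss wall» from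
the CONE LAW, independently of the layer transport.) [new] [folklore] -/
theorem switch_law (hroot : IsRoot q s₀) (W : ForcedWalk q s₀) (u : ℕ) {i j : Fin 3} {k m s : ℕ} {c : K}
    {V : MvPolynomial (Fin 3) K} (hil : i ≠ W.j u) (hjl : j ≠ W.j u) (hij : i ≠ j)
    (hr : (W.st u).r = Finsupp.single i k + Finsupp.single j m)
    (hsh : (W.st u).shade = (s : ℕ∞)) (hplat : (W.st (u + 1)).shade = (W.st u).shade) (hq : q < s + k + m)
    (h1s : 1 ≤ s) (ha : c * coeff 0 V ≠ 0)
    (hlayer : ∀ D : Fin 3 →₀ ℕ, D j = m → coeff D (W.st u).F =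
      coeff D (monomial (Finsupp.single i k + Finsupp.single j m + Finsupp.single (W.j u) s) c * V)) :
    ordZero (W.st u).F = ((s + k + m : ℕ) : ℕ∞) ∧ W.b u j ≠ 0 ∧
      resForm W u (s + k + m) = C ((c * coeff 0 V) / (-W.b u j) ^ s) * X j ^ s := by
  classical
  obtain ⟨o, ho, -⟩ := walk_nat hroot W u
  obtain ⟨n, hn, hon⟩ := order_eq_shade_add_degree hroot W u ho
  have hns : n = s := by
    have h := hsh
    rw [hn] at h
    exact_mod_cast h
  subst hns
  have hrdeg : (W.st u).r.degree = k + m := by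
    rw [hr, map_add, Finsupp.degree_single, Finsupp.degree_single]
  have hos : o = n + k + m := by rw [hrdeg] at hon; omega
  subst hos
  refine ⟨ho, ?_⟩
  have hcone := cone_of_plateau hroot W u ho hq hplat hn
  -- the `u_j`-free coefficients of the dehomogenised residual layer `R`
  have hRfree : ∀ c' : ℕ, coeff (Finsupp.single i c') (resLayer (W.j u) (W.st u) (n + k + m)) =
      if c' = 0 then c * coeff 0 V else 0 := by
    intro c'
    by_cases hc : c' ≤ n
    · have hm' : (Finsupp.single i c' + Finsupp.single (W.j u) (n - c')).degree + (W.st u).r.degree = n + k + m := by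
        rw [map_add, Finsupp.degree_single, Finsupp.degree_single, hrdeg]
        omega
      have hupd : (Finsupp.single i c' + Finsupp.single (W.j u) (n - c')).update (W.j u) 0 = Finsupp.single i c' := by
        ext w
        rw [update_apply', Finsupp.add_apply]
        by_cases hw : w = W.j u
        · rw [if_pos hw, hw, Finsupp.single_eq_of_ne hil.symm]
        · rw [if_neg hw, Finsupp.single_eq_of_ne hw, add_zero]
      rw [← hupd, coeff_resLayer (W.j u) (W.st u) (walk_r hroot W u) _ _ hm']
      have hDj : ((W.st u).r + (Finsupp.single i c' + Finsupp.single (W.j u) (n - c'))) j = m := by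
        rw [hr, Finsupp.add_apply, Finsupp.add_apply, Finsupp.add_apply, Finsupp.single_eq_same,
          Finsupp.single_eq_of_ne hij.symm, Finsupp.single_eq_of_ne hij.symm, Finsupp.single_eq_of_ne hjl, zero_add,
          zero_add, add_zero]
      rw [hlayer _ hDj, coeff_monomial_mul', hr]
      by_cases hc0 : c' = 0
      · subst hc0
        rw [if_pos rfl, Finsupp.single_zero, zero_add, Nat.sub_zero, if_pos le_rfl, tsub_self]
      · rw [if_neg hc0, if_neg]
        intro hle
        apply hc0
        have h := Finsupp.le_def.mp hle (W.j u)
        simp only [Finsupp.add_apply, Finsupp.single_eq_same, Finsupp.single_eq_of_ne hil.symm,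
          Finsupp.single_eq_of_ne hjl.symm] at h
        omega
    · rw [if_neg (by omega)]
      by_contra hne
      have hA := degree_le_of_mem_support_resLayer (W.j u) (W.st u) (walk_r hroot W u) (n + k + m)
        (mem_support_iff.mpr hne)
      rw [Finsupp.degree_single, hrdeg] at hA
      omega
  have hΦl : ∀ A ∈ (resForm W u (n + k + m)).support, A (W.j u) = 0 := fun A hA => by
    by_contra h
    exact (mem_support_iff.mp hA) (coeff_resForm_eq_zero W u _ h)
  have hdegΦ : ∀ A ∈ (resForm W u (n + k + m)).support, A.degree = n := fun A hA => by
    by_contra h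
    exact (mem_support_iff.mp hA) (hcone.1.coeff_eq_zero h)
  have hRΦ : resLayer (W.j u) (W.st u) (n + k + m) = PointBlowup.translate (-W.b u) (resForm W u (n + k + m)) := by
    unfold resForm
    rw [translate_translate, neg_add_cancel, PointBlowup.translate_zero]
  -- the move leaves the loss wall
  have hbj : W.b u j ≠ 0 := by
    intro hb0
    have h1 : coeff (Finsupp.single i n) (resForm W u (n + k + m)) = 0 := by
      have h := hRfree n
      rw [if_neg (by omega : n ≠ 0), hRΦ,
        coeff_translate_of_degree (-W.b u) _ (fun A hA => (hdegΦ A hA).le) (by rw [Finsupp.degree_single])] at h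
      exact h
    have h0 := hRfree 0
    rw [if_pos rfl, hRΦ, Finsupp.single_zero] at h0
    apply ha
    rw [← h0]
    conv_lhs => rw [(resForm W u (n + k + m)).as_sum, PointBlowup.translate_finset_sum, coeff_sum]
    refine Finset.sum_eq_zero (fun A hA => ?_)
    by_cases hAj : A j = 0
    · exfalso
      have hAl := hΦl A hA
      have hdeg := hdegΦ A hA
      rw [degree_fin3 hij hil hjl, hAj, hAl, add_zero, add_zero] at hdeg
      have hAeq : A = Finsupp.single i n := by
        rw [finsupp_fin3_eq hij hil hjl A, hAj, hAl, hdeg, Finsupp.single_zero, Finsupp.single_zero, add_zero, add_zero]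
      rw [hAeq] at hA
      exact (mem_support_iff.mp hA) h1
    · exact coeff_translate_monomial_eq_zero_of_apply_eq_zero (-W.b u) A 0 _ (i := j)
        (by rw [Pi.neg_apply, hb0, neg_zero]) (by rw [Finsupp.zero_apply]; omega)
  refine ⟨hbj, ?_⟩
  -- the form `Φ − φ₀ u_j^n` is killed by the rigidity lemma
  have hX : (C ((c * coeff 0 V) / (-W.b u j) ^ n) * X j ^ n : MvPolynomial (Fin 3) K).IsHomogeneous n := by
    have h := (isHomogeneous_C (Fin 3) ((c * coeff 0 V) / (-W.b u j) ^ n)).mul (isHomogeneous_X_pow (R := K) j n)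
    rwa [zero_add] at h
  have hΨ := eq_zero_of_translate_free (-W.b u) hij hil hjl (by rw [Pi.neg_apply, neg_ne_zero]; exact hbj)
    (resForm W u (n + k + m) - C ((c * coeff 0 V) / (-W.b u j) ^ n) * X j ^ n) (hcone.1.sub hX) ?_ ?_
  · exact sub_eq_zero.mp hΨ
  · intro A hA
    by_contra h
    apply mem_support_iff.mp hA
    rw [coeff_sub, coeff_resForm_eq_zero W u _ h, coeff_C_mul, coeff_X_pow, if_neg, mul_zero, sub_zero]
    intro hAeq
    apply h
    rw [← hAeq, Finsupp.single_eq_of_ne hjl.symm]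
  · intro c'
    have tsub : PointBlowup.translate (-W.b u) (resForm W u (n + k + m) - C ((c * coeff 0 V) / (-W.b u j) ^ n) * X j ^ n)
        = PointBlowup.translate (-W.b u) (resForm W u (n + k + m)) -
          PointBlowup.translate (-W.b u) (C ((c * coeff 0 V) / (-W.b u j) ^ n) * X j ^ n) := by
      unfold PointBlowup.translate
      exact map_sub _ _ _
    rw [tsub, coeff_sub, ← hRΦ, hRfree, translate_C_mul_X_pow, Pi.neg_apply, C_neg, ← sub_eq_add_neg, coeff_C_mul,
      coeff_single_X_sub_C_pow hij]
    by_cases hc0 : c' = 0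
    · rw [if_pos hc0, if_pos hc0, div_mul_cancel₀ _ (pow_ne_zero _ (neg_ne_zero.mpr hbj)), sub_self]
    · rw [if_neg hc0, if_neg hc0, mul_zero, sub_zero]

/-- **X2 SWITCH LAW — dehomogenised initial form (PROVED):** under the hypotheses of `switch_law`,
`resLayer l (W.st u) o = C φ₀ · (u_j − β_j)^s`; homogenising at `l`: `in(F_u) = u^{r_u} · φ₀ · (u_j − β_j·u_l)^s` — the
tangent cone of `F_u / u^{r_u}` is the `s`-fold plane `u_j = β_j u_l` through the point, transverse to the loss
wall. [new] [folklore] -/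
theorem switch_resLayer (hroot : IsRoot q s₀) (W : ForcedWalk q s₀) (u : ℕ) {i j : Fin 3} {k m s : ℕ} {c : K}
    {V : MvPolynomial (Fin 3) K} (hil : i ≠ W.j u) (hjl : j ≠ W.j u) (hij : i ≠ j)
    (hr : (W.st u).r = Finsupp.single i k + Finsupp.single j m)
    (hsh : (W.st u).shade = (s : ℕ∞)) (hplat : (W.st (u + 1)).shade = (W.st u).shade) (hq : q < s + k + m)
    (h1s : 1 ≤ s) (ha : c * coeff 0 V ≠ 0)
    (hlayer : ∀ D : Fin 3 →₀ ℕ, D j = m → coeff D (W.st u).F =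
      coeff D (monomial (Finsupp.single i k + Finsupp.single j m + Finsupp.single (W.j u) s) c * V)) :
    resLayer (W.j u) (W.st u) (s + k + m) = C ((c * coeff 0 V) / (-W.b u j) ^ s) * (X j - C (W.b u j)) ^ s := by
  have h := (switch_law hroot W u hil hjl hij hr hsh hplat hq h1s ha hlayer).2.2
  unfold resForm at h
  have h2 := congrArg (PointBlowup.translate (-W.b u)) h
  rw [translate_translate, neg_add_cancel, PointBlowup.translate_zero, translate_C_mul_X_pow] at h2
  rw [h2, Pi.neg_apply, C_neg, ← sub_eq_add_neg]

/-- **X2 SWITCH LAW — initial form (PROVED):** for every `|E| = s`, `coeff_{r_u + E} F_u = φ₀ · coeff_E (u_j −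
β_j·u_l)^s`. [new] [folklore] -/
theorem switch_initialForm (hroot : IsRoot q s₀) (W : ForcedWalk q s₀) (u : ℕ) {i j : Fin 3} {k m s : ℕ} {c : K}
    {V : MvPolynomial (Fin 3) K} (hil : i ≠ W.j u) (hjl : j ≠ W.j u) (hij : i ≠ j)
    (hr : (W.st u).r = Finsupp.single i k + Finsupp.single j m)
    (hsh : (W.st u).shade = (s : ℕ∞)) (hplat : (W.st (u + 1)).shade = (W.st u).shade) (hq : q < s + k + m)
    (h1s : 1 ≤ s) (ha : c * coeff 0 V ≠ 0)
    (hlayer : ∀ D : Fin 3 →₀ ℕ, D j = m → coeff D (W.st u).F =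
      coeff D (monomial (Finsupp.single i k + Finsupp.single j m + Finsupp.single (W.j u) s) c * V))
    (E : Fin 3 →₀ ℕ) (hE : E.degree = s) :
    coeff ((W.st u).r + E) (W.st u).F =
      ((c * coeff 0 V) / (-W.b u j) ^ s) * coeff E ((X j - C (W.b u j) * X (W.j u)) ^ s) := by
  classical
  have hrdeg : (W.st u).r.degree = k + m := by
    rw [hr, map_add, Finsupp.degree_single, Finsupp.degree_single]
  rw [← coeff_resLayer (W.j u) (W.st u) (walk_r hroot W u) (s + k + m) E (by rw [hE, hrdeg, add_assoc]),
    switch_resLayer hroot W u hil hjl hij hr hsh hplat hq h1s ha hlayer, coeff_C_mul, coeff_update_linear_pow hjl _ hE]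

/-- **AFTER THE SWITCH — THE NEW WALL'S LAYER (PROVED):** the layer of `F_{u+1}` of `u_l`-degree exactly `s+k+m−q` (the mass
of the wall created by the switch) is `φ₀ · (u_i + β_i)^k (u_j + β_j)^m · u_j^s`: for `E_l = 0`,
`coeff_{E + (s+k+m−q)e_l} F_{u+1} = φ₀ · coeff_E ((X_i + C β_i)^k (X_j + C β_j)^m X_j^s)`. [new] [folklore] -/
theorem switch_succ_layer (hroot : IsRoot q s₀) (W : ForcedWalk q s₀) (u : ℕ) {i j : Fin 3} {k m s : ℕ} {c : K}
    {V : MvPolynomial (Fin 3) K} (hil : i ≠ W.j u) (hjl : j ≠ W.j u) (hij : i ≠ j)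
    (hr : (W.st u).r = Finsupp.single i k + Finsupp.single j m)
    (hsh : (W.st u).shade = (s : ℕ∞)) (hplat : (W.st (u + 1)).shade = (W.st u).shade) (hq : q < s + k + m)
    (h1s : 1 ≤ s) (ha : c * coeff 0 V ≠ 0)
    (hlayer : ∀ D : Fin 3 →₀ ℕ, D j = m → coeff D (W.st u).F =
      coeff D (monomial (Finsupp.single i k + Finsupp.single j m + Finsupp.single (W.j u) s) c * V))
    (E : Fin 3 →₀ ℕ) (hEl : E (W.j u) = 0) :
    coeff (E + Finsupp.single (W.j u) (s + k + m - q)) (W.st (u + 1)).F =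
      ((c * coeff 0 V) / (-W.b u j) ^ s) * coeff E ((X i + C (W.b u i)) ^ k * (X j + C (W.b u j)) ^ m * X j ^ s) := by
  classical
  have ho := (switch_law hroot W u hil hjl hij hr hsh hplat hq h1s ha hlayer).1
  obtain ⟨o₁, ho₁, -, ho2⟩ := NoJump.order_lt_two_mul hroot W u
  have hoo : o₁ = s + k + m := by
    have h := ho₁.symm.trans ho
    exact_mod_cast h
  rw [hoo] at ho2
  have h := coeff_step_layer (W.j u) (W.b u) (W.onExc u) (W.st u) (o := s + k + m) (by omega) ho2 hEl
  rw [← W.st_succ] at h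
  have hupd : (W.st u).r.update (W.j u) 0 = Finsupp.single i k + Finsupp.single j m := by
    rw [hr]
    exact update_zero_of_apply_eq_zero (by
      rw [Finsupp.add_apply, Finsupp.single_eq_of_ne hil.symm, Finsupp.single_eq_of_ne hjl.symm, add_zero])
  have hmono : monomial (Finsupp.single i k + Finsupp.single j m) (1 : K) = X i ^ k * X j ^ m := by
    rw [X_pow_eq_monomial, X_pow_eq_monomial, monomial_mul, one_mul]
  rw [h, initLayer_eq_mul (W.j u) (W.st u) (walk_r hroot W u) (s + k + m), switch_resLayer hroot W u hil hjl hij hr hsh hplat hq h1s ha hlayer, hupd, hmono]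
  unfold PointBlowup.translate
  rw [map_mul, map_mul, map_mul, map_pow, map_pow, map_pow, map_sub, MvPolynomial.aeval_X, MvPolynomial.aeval_X,
    MvPolynomial.aeval_C, MvPolynomial.aeval_C, MvPolynomial.algebraMap_eq, add_sub_cancel_right,
    show (X i + C (W.b u i)) ^ k * (X j + C (W.b u j)) ^ m * (C ((c * coeff 0 V) / (-W.b u j) ^ s) * X j ^ s) =
      C ((c * coeff 0 V) / (-W.b u j) ^ s) * ((X i + C (W.b u i)) ^ k * (X j + C (W.b u j)) ^ m * X j ^ s) by ring,
    coeff_C_mul]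

/-- **THE BOUNDARY AFTER A SWITCH THAT KEEPS THE RUN WALL (PROVED, ledger):** if `W.b u i = 0` then
`r_{u+1} = k·e_i + (s+k+m−q)·e_l` (the loss wall `j` is lost: `β_j ≠ 0`). [folklore] -/
theorem switch_succ_r (hroot : IsRoot q s₀) (W : ForcedWalk q s₀) (u : ℕ) {i j : Fin 3} {k m s : ℕ} {c : K}
    {V : MvPolynomial (Fin 3) K} (hil : i ≠ W.j u) (hjl : j ≠ W.j u) (hij : i ≠ j)
    (hr : (W.st u).r = Finsupp.single i k + Finsupp.single j m)
    (hsh : (W.st u).shade = (s : ℕ∞)) (hplat : (W.st (u + 1)).shade = (W.st u).shade) (hq : q < s + k + m)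
    (h1s : 1 ≤ s) (ha : c * coeff 0 V ≠ 0)
    (hlayer : ∀ D : Fin 3 →₀ ℕ, D j = m → coeff D (W.st u).F =
      coeff D (monomial (Finsupp.single i k + Finsupp.single j m + Finsupp.single (W.j u) s) c * V))
    (hβ : W.b u i = 0) :
    (W.st (u + 1)).r = Finsupp.single i k + Finsupp.single (W.j u) (s + k + m - q) := by
  classical
  have hlaw := switch_law hroot W u hil hjl hij hr hsh hplat hq h1s ha hlayer
  rw [r_succ_eq W u hlaw.1]
  congr 1
  ext w
  rw [kept_apply, hr, Finsupp.add_apply]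
  by_cases hw : w = W.j u
  · rw [if_neg (fun h => h.1 hw), hw, Finsupp.single_eq_of_ne hil.symm]
  · by_cases hwi : w = i
    · rw [hwi, if_pos ⟨hil, hβ⟩, Finsupp.single_eq_same, Finsupp.single_eq_of_ne hij, add_zero]
    · rw [Finsupp.single_eq_of_ne hwi]
      split_ifs with hc
      · have hwj : w ≠ j := fun h => hlaw.2.1 (h ▸ hc.2)
        rw [Finsupp.single_eq_of_ne hwj, add_zero]
      · rfl

end Switch

end Summit.ResolutionOfSingularities.ResolutionOfSingularities.Theorems.LossExitCone
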